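import Summits.Ventures.AbcSig.Rows.TemplateC2a
import Summits.Ventures.AbcSig.Levels.N37
import Summits.Ventures.AbcSig.Levels.N74

/-!
# Venture AbcSig — ROW (census C2a pilot, `ℓ = 37`, class `a ≥ 6`): `xⁿ + 2^a·37^m·yⁿ = z²`

HONEST FRAMING. A row of a COMPUTATION cell (`pub-abcsig`); a CONDITIONAL theorem, no claim on ABC or any summit.
Row class (cell language): SHARPENING candidate — printed state of the art is Ivorra–Kraus 2006, Thm. 1.1(3)(i)
(`ℓ = 37 ≡ 5 (mod 8)`, `n ≥ 6`): no solutions for primes `p > (√(32·38)+1)^{8·36}`; see the cell's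
`census/rows-test/C2a-l37-a_ge_6-PILOT.md` for R0–R8. What this file PROVES (kernel-checked), via the class
templates `rowC2a_a6` / `rowC2a_age7` of `Rows/TemplateC2a.lean`: for every abstract newform model `M` and every
prime `n ≥ 11`, `n ≠ 37`,

  `BS04Package M` (CITED) `→ DataComplete M 37 level37Orbits → DataComplete M 74 level74Orbits` (COMPUTED, two
  engines agree: census/levels/N37.agree.json, N74.agree.json)
  `→ (n = 19 → Excludes M 74 orbit_74_1 …)` (CITED/COMPUTED module M6 of the cell: the orbit `74.1` (field `x²+x−1`,
     engine-2 numbering; = 74.2 of engine-1/msgf) is congruent to an Eisenstein series modulo the prime `(19, θ − 4)`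
     up to the Sturm bound `19` — certificate `M6_N74_74.2_n19.json`, referee-verified 2026-08-22T06:06Z — hence
     `ρ̄_{f,ν}` is reducible and cannot be `ρ^E_n` [BS04, Cor. 3.1]; the other prime of `ℚ(θ)` above `19` is killed by
     the kernel sieve, which is why only this hypothesis is needed; NOT yet a Lean certificate)
  `→` for all `a ≥ 6`, `m ≥ 1` with `a, m < n` (B `n`-th-power free, [BS04, p. 29]): `xⁿ + 2^a 37^m yⁿ = z²` has no
     solution in nonzero pairwise coprime integers with `|xy| > 1`.

Residual exponent `7` of orbit `37.1` is below the range `n ≥ 11`.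
-/

namespace Summit.Ventures.AbcSig

/-- **Row `C2a-l37-a_ge_6`** (see the module docstring for the hypotheses and their status). -/
theorem row_C2a_37_a_ge_6 (M : NewformModel) (hP : M.BS04Package)
    (hD37 : M.DataComplete 37 level37Orbits) (hD74 : M.DataComplete 74 level74Orbits)
    (n : ℕ) (hn : n.Prime) (h11 : 11 ≤ n) (hn37 : n ≠ 37) (a m : ℕ) (ha : 6 ≤ a) (hm : 1 ≤ m)
    (han : a < n) (hmn : m < n)
    (hM6 : n ∈ ([19] : List ℕ) →
      M.Excludes 74 orbit_74_1 (famB (2 ^ a * 37 ^ m) n (fun _ _ => True)))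
    (x y z : ℤ) (hxy1 : x * y ≠ 1) (hxy2 : x * y ≠ -1) :
    ¬ IsPrimitiveSolution 1 (2 ^ a * 37 ^ m) 1 n x y z := by
  have h37 : Nat.Prime 37 := by norm_num
  have h7 : 7 ≤ n := by omega
  have hS74 := level74_sieve n hn h7 (fun o => M.Excludes 74 o (famB (2 ^ a * 37 ^ m) n (fun _ _ => True))) hM6
  have hS37 := level37_sieve n hn h7 (fun o => M.Excludes 37 o (famB (2 ^ a * 37 ^ m) n (fun _ _ => True)))
    (fun h => absurd h (by simp only [List.mem_cons, List.not_mem_nil, or_false]; omega))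
  by_cases ha6 : a = 6
  · subst ha6
    exact rowC2a_a6 37 h37 (by norm_num) M hP n hn h7 hn37 hD37 hD74 m hm hmn hS37 hS74 x y z hxy1 hxy2
  · exact rowC2a_age7 37 h37 (by norm_num) M hP n hn h7 hn37 hD74 a m (by omega) hm han hmn hS74 x y z hxy1 hxy2

end Summit.Ventures.AbcSig
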